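import Summits.PneNP.PneNP.Theses.RootDecompMagnificationPayout
import Summits.PneNP.PneNP.Theorems.GapMCSPWindowCellZero

/-!
# `RootDecompMagnificationPayout.WindowCellZero` (stmt-PneNP-33309) — the `q = 0` cell of the gap-MCSP window dial, PROVED

Node N40 of the decomp-pnenp root-decomposition cell (route `route-PneNP-RootDecompMagnificationPayout`,
lens-1 g10 «MagnificationPayout») cuts the root on the gap-MCSP circuit-size window `N·⌊log₂N⌋^q + q`.  Its
rev-1 aside `WindowCellZero` records the `q = 0` leaf: for every `c ≥ 1` there is `β₀ > 0` such that for all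
`0 < β < β₀` the Oliveira–Pich–Santhanam problem `Gap-MCSP[2^{βn}/(cn), 2^{βn}]` is not separated by
`B₂`-circuit families of eventually `≤ N·⌊log₂N⌋^0 + 0 = N` gates.  This file closes the item BY NAME from the
tree theorem `GapMCSPWindowCellZero.gapMCSP_R3_not_mem_SIZEae_id` (the size–acceptance trade-off law of lens-1
g13 «TradeOffLaw», HOME/decomp-pnenp-lens-1/TradeOffLaw.lean sha256 880b490f…, critic NODE-VERDICT
2026-08-30T13:09:32Z CLEARED; `β₀ = 1/3`).  A BC5 rung strictly between the floor `WindowFloor`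
(stmt-PneNP-32098, `N − ⌈N^{β′}⌉`) and the attacked crux `CircuitWindowShadowOne` (stmt-PneNP-32096,
`N·log N + 1`).  0 sorry; nothing here bears on P vs NP beyond this S-free lower bound.
-/

set_option linter.dupNamespace false -- `Summit.PneNP.PneNP.…`: summit = sub-problem name (D-0017 single-conjunct layout)

namespace Summit.PneNP.PneNP.Theorems

open Literature.Computability.Complexity Literature.Computability.MetaComplexity

/-- The `q = 0` window cell (stmt-PneNP-33309, `WindowCellZero`): for every `c ≥ 1`, with `β₀ = 1/3`, for all
`0 < β < β₀`, `Gap-MCSP[yesBound c β, noBound β] ∉ promiseLift (SIZEae fun N => N·⌊log₂N⌋^0 + 0)` — the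
window at `q = 0` is the identity size bound, and the cell is the tree theorem
`GapMCSPWindowCellZero.gapMCSP_R3_not_mem_SIZEae_id` (trade-off law `G ≥ N + N/(9L) − L − 3` for every
`B₂`-circuit accepting the weight-`≤ 1` ball; decomp-pnenp cell, lens-1 g13, 2026-08-30). [folklore] -/
theorem windowCellZero_proof :
    Summit.PneNP.PneNP.Theses.RootDecompMagnificationPayout.WindowCellZero := by
  unfold Summit.PneNP.PneNP.Theses.RootDecompMagnificationPayout.WindowCellZero
  intro c hc
  refine ⟨1 / 3, by norm_num, fun β hβ hβ3 => ?_⟩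
  have hwin : (fun N : ℕ => N * Nat.log 2 N ^ 0 + 0) = fun N : ℕ => N := funext fun N => by simp
  rw [hwin]
  exact GapMCSPWindowCellZero.gapMCSP_R3_not_mem_SIZEae_id c hc β hβ hβ3

end Summit.PneNP.PneNP.Theorems
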